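import Literature.Probability.LatticeModels.FreeStateGibbs
import Literature.Probability.LatticeModels.GibbsSpecificationProofs
import Literature.Probability.LatticeModels.GibbsSpecificationDLRProofs
import HarnessLib

/-!
# Spin-flip symmetry of the zero-field Ising Gibbs measures

Topic `Probability/LatticeModels`, namespace `Literature.Probability.LatticeModels`. Theorem-only file
(no definitions, no named facts). For the Ising model on a locally finite graph with countable
vertex set at zero magnetic field, the global spin flip `σ ↦ -σ` maps the finite-volume Gibbs
measure with boundary condition `η` to the one with boundary condition `-η`, and therefore maps
the set of DLR (Gibbs) measures `𝒢(β, 0)` onto itself (Friedli–Velenik 2017, §3.7.1, spin-flip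
symmetry, and §6.2, `𝒢(β,0)` is invariant under the flip; Georgii 2011, §6.2 / (5.?) symmetries
of specifications):

* `spinCorr_map_neg` — the flip (measurable: Mathlib's `measurable_neg` for the product of the
  discrete groups `ℤˣ`) multiplies the correlation `⟨σ_A⟩` by `(-1)^{|A|}`;
* `isingMeasure_fixed_map_neg` — `μ^{η}_{Λ;β,0} ∘ (σ ↦ -σ)⁻¹ = μ^{-η}_{Λ;β,0}` (from the tree's
  correlation identity `isingCorr_fixed_flip_holds`, two probability measures on `{±1}^V` with the
  same correlations being equal, `measure_eq_of_forall_spinCorr_eq`);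
* `dlr_map_neg`, `isGibbsMeasure_map_neg` — the image of a (finite) DLR measure / Gibbs measure at
  `h = 0` under the flip is again one.

Used in the decomposition of zero-field Gibbs measures with the even correlations of `μ⁺` into
mixtures of `μ⁺` and `μ⁻` (`IsingGibbsMixture.lean`).

## Mathlib status

Anchors: `measurable_neg` (instance `MeasurableNeg` of the product `V → ℤˣ`), `Measure.map_apply`,
`integral_map`, `lintegral_map`; tree: `isingCorr_fixed_flip_holds` (`IsingModel.lean`),
`measure_eq_of_forall_spinCorr_eq` (`FreeStateGibbs.lean`), `isSpecification_isingSpecification_holds`.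
-/

noncomputable section

open MeasureTheory Finset

namespace Literature.Probability.LatticeModels

variable {V : Type*}

/-! ### The global spin flip -/

/-- **Correlations of the flipped measure**: `⟨σ_A⟩_{μ ∘ flip⁻¹} = (-1)^{|A|} ⟨σ_A⟩_μ`
(Friedli–Velenik 2017, §3.7.1). [cite: FriedliVelenik2017, §3.7.1] -/
theorem spinCorr_map_neg (μ : Measure (SpinConfig V)) (A : Finset V) :
    spinCorr (μ.map fun σ : SpinConfig V => -σ) A = (-1) ^ #A * spinCorr μ A := by
  rw [spinCorr, spinCorr, integral_map measurable_neg.aemeasurable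
    (measurable_spinProduct A).aestronglyMeasurable, ← integral_const_mul]
  exact integral_congr_ae (Filter.Eventually.of_forall fun σ => spinProduct_neg A σ)

/-- The flip is an involution on measures: `(μ ∘ flip⁻¹) ∘ flip⁻¹ = μ`. [folklore] -/
theorem map_neg_map_neg (μ : Measure (SpinConfig V)) :
    (μ.map fun σ : SpinConfig V => -σ).map (fun σ : SpinConfig V => -σ) = μ := by
  rw [Measure.map_map measurable_neg measurable_neg]
  have h : ((fun σ : SpinConfig V => -σ) ∘ fun σ : SpinConfig V => -σ) = id := funext fun σ => neg_neg σ
  rw [h, Measure.map_id]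

section Ising

variable (G : SimpleGraph V) [DecidableEq V] [G.LocallyFinite]

/-- **The flip maps `μ^{η}_{Λ;β,0}` to `μ^{-η}_{Λ;β,0}`** (Friedli–Velenik 2017, §3.7.1: at `h = 0`
the Hamiltonian is invariant under the simultaneous flip of the configuration and of the boundary
condition): both sides are probability measures on `{±1}^V` with the correlations
`(-1)^{|A|} ⟨σ_A⟩^{η}_{Λ;β,0}` (`isingCorr_fixed_flip_holds`), hence equal (Lemma 3.19). [cite: FriedliVelenik2017, §3.7.1] -/
theorem isingMeasure_fixed_map_neg (Λ : Finset V) (β : ℝ) (η : SpinConfig V) :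
    (isingMeasure G Λ β 0 (.fixed η)).map (fun σ : SpinConfig V => -σ) =
      isingMeasure G Λ β 0 (.fixed (-η)) := by
  haveI : IsProbabilityMeasure ((isingMeasure G Λ β 0 (.fixed η)).map fun σ : SpinConfig V => -σ) :=
    Measure.isProbabilityMeasure_map measurable_neg.aemeasurable
  refine measure_eq_of_forall_spinCorr_eq _ _ fun A => ?_
  rw [spinCorr_map_neg, ← isingCorr_eq_spinCorr, ← isingCorr_eq_spinCorr]
  have key := isingCorr_fixed_flip_holds G Λ β 0 η A
  rw [neg_zero] at key
  exact key.symm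

/-- The Ising kernel at zero field commutes with the flip on events:
`γ_Λ(flip⁻¹ A | η) = γ_Λ(A | -η)` (Friedli–Velenik 2017, §3.7.1). [cite: FriedliVelenik2017, §3.7.1] -/
theorem isingSpecification_apply_preimage_neg (β : ℝ) (Λ : Finset V) (η : SpinConfig V)
    {A : Set (SpinConfig V)} (hA : MeasurableSet A) :
    isingSpecification G β 0 Λ η ((fun σ : SpinConfig V => -σ) ⁻¹' A) =
      isingSpecification G β 0 Λ (-η) A := by
  rw [isingSpecification_apply, isingSpecification_apply, ← isingMeasure_fixed_map_neg,
    Measure.map_apply measurable_neg hA]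

variable [Countable V]

/-- **The flip preserves the DLR equations at zero field** (Friedli–Velenik 2017, §6.2 with §3.7.1;
Georgii 2011, §5.1, symmetries of a specification map `𝒢(γ)` to itself): if a measure `ν`
satisfies `∫ γ_Λ(A|η) ν(dη) = ν(A)` for the Ising specification at `(β, 0)`, so does `ν ∘ flip⁻¹`:
`(ν∘flip⁻¹)(A) = ν(flip⁻¹A) = ∫ γ_Λ(flip⁻¹A|η) dν = ∫ γ_Λ(A|-η) dν = ∫ γ_Λ(A|η') d(ν∘flip⁻¹)`. [cite: FriedliVelenik2017, §3.7.1 and §6.2] -/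
theorem dlr_map_neg (β : ℝ) {ν : Measure (SpinConfig V)}
    (hν : ∀ (Λ : Finset V) (A : Set (SpinConfig V)), MeasurableSet A →
      ∫⁻ η, isingSpecification G β 0 Λ η A ∂ν = ν A) :
    ∀ (Λ : Finset V) (A : Set (SpinConfig V)), MeasurableSet A →
      ∫⁻ η, isingSpecification G β 0 Λ η A ∂(ν.map fun σ : SpinConfig V => -σ) =
        (ν.map fun σ : SpinConfig V => -σ) A := by
  intro Λ A hA
  have hγ : IsSpecification (isingSpecification G β 0) := isSpecification_isingSpecification_holds G β 0
  have hpre : MeasurableSet ((fun σ : SpinConfig V => -σ) ⁻¹' A) := measurable_neg hA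
  rw [lintegral_map (hγ.measurable_coe Λ hA) measurable_neg,
    Measure.map_apply measurable_neg hA, ← hν Λ _ hpre]
  refine lintegral_congr fun η => ?_
  rw [isingSpecification_apply_preimage_neg G β Λ η hA]

/-- **`𝒢(β, 0)` is invariant under the global spin flip** (Friedli–Velenik 2017, §3.7.1 and §6.2;
Georgii 2011, §5.1): if `μ` is a Gibbs measure for the Ising specification at zero field, so is
`μ ∘ flip⁻¹`. [cite: FriedliVelenik2017, §3.7.1 and §6.2] -/
theorem isGibbsMeasure_map_neg (β : ℝ) {μ : Measure (SpinConfig V)}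
    (hμ : IsGibbsMeasure (isingSpecification G β 0) μ) :
    IsGibbsMeasure (isingSpecification G β 0) (μ.map fun σ : SpinConfig V => -σ) := by
  haveI := hμ.isProbabilityMeasure
  exact ⟨Measure.isProbabilityMeasure_map measurable_neg.aemeasurable,
    dlr_map_neg G β hμ.2⟩

end Ising

end Literature.Probability.LatticeModels
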